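import Literature.NumberTheory.Automorphic.Liu2021.Def411WeilCarriersCentralTypeGaussian
import HarnessLib

/-!
# X3-Char item (E), supplier form: a weight-one character `μ` with `s = ι_μ`, for every continuous compatible splitting in
# the central-type fibre ([Liu2021, Def. 4.3, App. D Step 2]; [GelbartRogawski1991, §3.1 Remark p. 457])

Topic `NumberTheory/Automorphic/Liu2021`; namespace `Literature.NumberTheory.GelbartRogawski1991.GRConstruction`.  KERNEL ONLY:
proved theorems; 0 definitions, 0 records, 0 named facts, 0 `sorry`.  Sequel of `Def411WeilCarriersCentralTypeGaussian` (✔):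
its end theorem `exists_eq_chiSplittingLine_twist_weightOne_of_center_gaussianV_cm` produces a twisting character `α` with
`s = ι_{toHecke μ₀ · α̃}` and `toHecke (μ₀ ⊛ α) = toHecke μ₀ · α̃`; the Δ2 bridge of the COR-CM cell wants, per index line, a REAL
character `μ` (the `μ`-field of `Thm418Rest`, [Liu2021, Def. 4.1–4.3]) with `s = ι_{toHecke μ}` LITERALLY.  This file repackages:

* `chiSplittingLine_congr` — `chiSplittingLine χ hχu hχs … = chiSplittingLine χ' hχu' hχs' …` for `χ = χ'` (the proof arguments ride
  along by proof irrelevance);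
* **`exists_weightOne_eq_chiSplittingLine_toHeckeCharacter_of_center_gaussianV_cm`** — under the hypotheses of the end theorem:
  `∃ μ (hμ : IsConjugateSymplectic μ), HasWeight μ 1 ∧ HasCMType μ Φ ∧ s = chiSplittingLine (toHeckeCharacter μ)
  (isUnitary_toHeckeCharacter μ) (isSplittingChar_toHeckeCharacter_of_isConjugateSymplectic μ hμ) …` — the supplier of the `μ`
  of [Liu2021, App. D Step 2] for every continuous index line of the COR-CM pin's central-type fibre.

HC_CM is NOT proved here or anywhere in the tree.  References: Y. Liu, Camb. J. Math. 9 (2021), Def. 4.1–4.3, Remark 4.2, App. D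
§D.1 Step 2 (l. 5219) [Liu2021]; S. Gelbart, J. Rogawski, Invent. Math. 105 (1991), §3.1 Remark p. 457 L4–13 [GelbartRogawski1991].
Provenance: pub-hodgecm2 (COR-CM) cell, seat pin-3 (gen 9), X3-Char item (E), BRIDGE RECIPE step (4).
-/

set_option autoImplicit false

noncomputable section

open scoped Classical
open scoped Matrix Kronecker TensorProduct SchwartzMap
open NumberField NumberField.InfinitePlace NumberField.mixedEmbedding IsDedekindDomain
open Literature.RepresentationTheory.HeisenbergGroup
open Literature.NumberTheory.Automorphic
open Literature.NumberTheory.Weil1964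
open Literature.RepresentationTheory.HarrisKudlaSweet1996
open Literature.NumberTheory.GaloisRepresentations
open Literature.Analysis.SegalBargmann

namespace Literature.NumberTheory.GelbartRogawski1991.GRConstruction

open UnitaryDualPair UnitaryDualPair.ArchSplitting
open Literature.NumberTheory.Automorphic.Liu2021.Def411WeilCarriersDoubling
open Literature.NumberTheory.GelbartRogawski1991.GRConstruction.DoubledWeilDetTwist
open Literature.NumberTheory.Automorphic.UnitaryGroup.AdelicCharactersArchType
open Literature.NumberTheory.Automorphic.IdeleClassGroup

variable (L : Type) [Field L] [NumberField L] [IsCMField L]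

variable {N n : ℕ} (e₁ : Fin N × Fin 1 ≃ Fin n)
  (dV : Fin N → L) (hdV : ∀ i, IsCMField.complexConj L (dV i) = dV i) (hdV0 : ∀ i, dV i ≠ 0)

/-- **`chiSplittingLine` depends on the character only** (the proofs `hχu`, `hχs` ride along): `χ = χ'` ⇒
`chiSplittingLine χ … = chiSplittingLine χ' …`. [cite: GelbartRogawski1991, §3.1 Prop. 3.1.1 p. 455 L1–3] -/
theorem chiSplittingLine_congr {χ χ' : HeckeCharacter L} (h : χ = χ') (hχu : χ.IsUnitary) (hχs : IsSplittingChar L 1 χ)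
    (hχu' : χ'.IsUnitary) (hχs' : IsSplittingChar L 1 χ') (TW : Matrix (Fin 1) (Fin 1) (Fp L)) (hWd : IsUnit TW.det)
    (JW : Matrix (Fin 1) (Fin 1) L) (hJW : JW = TW.map (algebraMap (Fp L) L)) :
    chiSplittingLine L e₁ dV hdV hdV0 χ hχu hχs TW hWd JW hJW = chiSplittingLine L e₁ dV hdV hdV0 χ' hχu' hχs' TW hWd JW hJW := by
  subst h
  rfl

set_option maxHeartbeats 2000000 in
-- (term-mode destructuring through the doubled telescope; `obtain` times out in `isDefEq` at default budget)
/-- **THE `μ`-SUPPLIER OF [Liu2021, App. D Step 2] ON THE CENTRAL-TYPE FIBRE**: at the CM datum `(diag dV, ⟨dW 0⟩)` (modulo the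
displayed predicate `hA`, ✔ for rank 3), for `μ₀` conjugate symplectic of weight one with CM type `Φ`, every CONTINUOUS compatible
splitting `s` through which the archimedean centre acts on ONE Gaussian test tensor `G_𝕍 ⊗ f` (`f ≠ 0`) by
`archWeight L (centralType (weightOneType Φ)) t` IS `ι_{toHecke μ}` — LITERALLY `chiSplittingLine (toHeckeCharacter μ) (isUnitary_…)
(isSplittingChar_… hμ) …` — for a character `μ` conjugate symplectic OF WEIGHT ONE with `Φ_μ = Φ`.
[cite: Liu2021, Def. 4.3, App. D §D.1 Step 2 (l. 5219)] [cite: GelbartRogawski1991, §3.1 Remark p. 457 L4–13] -/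
theorem exists_weightOne_eq_chiSplittingLine_toHeckeCharacter_of_center_gaussianV_cm [NeZero N]
    (dW₁ : Fin 1 → L) (hdW₁ : ∀ i, IsCMField.complexConj L (dW₁ i) = dW₁ i) (hdW₁0 : ∀ i, dW₁ i ≠ 0)
    (μ₀ : IdeleClassGroup L →ₜ* Circle) (hμ₀ : IsConjugateSymplectic L μ₀)
    (hA : CentralCharFactorsThroughDet (Fp L) L (IsCMField.complexConj L) N 1 e₁ (Matrix.diagonal dV) (Matrix.diagonal dW₁)
      (det_reindex_kronecker_diagonal_line_ne_zero L e₁ dV hdV0 (realDiagonal L dW₁ hdW₁)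
        (isUnit_det_realDiagonal L dW₁ hdW₁ hdW₁0) (Matrix.diagonal dW₁) (realDiagonal_map L dW₁ hdW₁).symm))
    (hw : HasWeight L μ₀ 1) {Φ : Literature.AlgebraicGeometry.Motives.CMType L} (hΦ : HasCMType L μ₀ Φ)
    {s : UnitaryGroup.adelicPair (Fp L) L (IsCMField.complexConj L) N 1 (Matrix.diagonal dV) (Matrix.diagonal dW₁) →*
      adelicMpCont (Fp L) (Fin n) (adelicGram (Fp L) e₁ (realDiagonal L dV hdV) (realDiagonal L dW₁ hdW₁))}
    (hsc : Continuous s) (hs : (cmSplittingDatum L e₁ dV hdV hdV0 dW₁ hdW₁ hdW₁0).IsCompatible s)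
    {f : FinSB (Fp L) (Fin n)} (hf : f ≠ 0)
    (h : ∀ t, pairRep (Fp L) L (IsCMField.complexConj L) N 1 e₁ (Matrix.diagonal dV) (Matrix.diagonal dW₁) s
        (CMCenter L dV (archUnit L t), 1) (piSchwartzBruhatEquiv (Fp L) (Fin n) (gaussianV L e₁ dV hdV hdV0 dW₁ hdW₁ hdW₁0 ⊗ₜ f)) =
      archWeight L (centralType L e₁ dV hdV dW₁ hdW₁ (weightOneType L Φ)) t •
        piSchwartzBruhatEquiv (Fp L) (Fin n) (gaussianV L e₁ dV hdV hdV0 dW₁ hdW₁ hdW₁0 ⊗ₜ f)) :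
    ∃ (μ : IdeleClassGroup L →ₜ* Circle) (hμ : IsConjugateSymplectic L μ),
      HasWeight L μ 1 ∧ HasCMType L μ Φ ∧
        s = chiSplittingLine L e₁ dV hdV hdV0 (toHeckeCharacter L μ) (isUnitary_toHeckeCharacter L μ)
              (isSplittingChar_toHeckeCharacter_of_isConjugateSymplectic L μ hμ) (realDiagonal L dW₁ hdW₁)
              (isUnit_det_realDiagonal L dW₁ hdW₁ hdW₁0) (Matrix.diagonal dW₁) (realDiagonal_map L dW₁ hdW₁).symm := by
  have H := exists_eq_chiSplittingLine_twist_weightOne_of_center_gaussianV_cm L dV hdV hdV0 e₁ dW₁ hdW₁ hdW₁0 μ₀ hμ₀ hA hw hΦ hsc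
    hs hf h
  exact H.elim fun α H1 => H1.elim fun hα H2 => H2.elim fun hαrat H3 => H3.elim fun hαu H4 => H4.elim fun hμ H5 =>
    ⟨twist L α hα hαrat μ₀, hμ, H5.2.2.1, H5.2.2.2 ▸ hμ.hasCMType_cmType,
      H5.1.trans (chiSplittingLine_congr L e₁ dV hdV hdV0 H5.2.1.symm _ _ _ _ _ _ _ _)⟩

end Literature.NumberTheory.GelbartRogawski1991.GRConstruction

end
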